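import Literature.Analysis.PDE.LinearWaveFrameSystem
import HarnessLib

/-!
# Linear scalar wave equations in frame variables, II: transport uniqueness and recovery of the
# second-order equation from the symmetric first-order system

Analysis/PDE support file (everything proved) continuing `LinearWaveFrameSystem.lean` (fact seat
`provefact-Literature.Geometry.Lorentzian.hawkingEllis_locallyUnique_vacuumDevelopment`).
The symmetric first-order system attached to `P f = −a f_tt + 2aβʲ f_tj + (Q − aββ) f_jk + …`
and a frame `e` of `Q` (`∑_l e_lʲ e_lᵏ = Q^{jk}`, inverse slice metric `h`, `h Q = 1`) has the
unknowns `(f, ϖ, ψ_l)` and the rows (`WaveFrame.rowPsi`, `WaveFrame.rowPi`)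

  `D₀ f = (√a)⁻¹ ϖ`,
  `D₀ ψ_l = (√a)⁻¹ e_lᵏ ∂_k ϖ + (D₀ e_lᵏ) F_k + (e_lᵏ ∂_k (√a)⁻¹) ϖ + e_lᵏ (∂_k βʲ) F_j`,
  `D₀ ϖ = (√a)⁻¹ (√a (D₀√a)(√a)⁻¹ ϖ − a (D₀βʲ) F_j + e_lʲ ∂_j ψ_l − e_lʲ (∂_j e_lᵏ) F_k
          + b_T ((√a)⁻¹ ϖ + βʲ F_j) + b_Xʲ F_j + c f)`,

where `F_k = ∑_m ẽ_{mk} ψ_m`, `ẽ_{mk} = ∑_j h_{kj} e_mʲ` (`WaveFrame.etil`, `WaveFrame.Fv`),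
stands for `f_k`. **Recovery** (`WaveFrame.eventually_P_eq_zero_of_rows`): for a smooth
solution of the three rows whose `ψ` satisfies the constraint `ψ_l = e_lᵏ f_k` at `t = 0` near
`x₁`, one has `ψ_l = e_lᵏ f_k` and `P f = 0` on a neighbourhood of `(0, x₁)`. Indeed the defects
`C_l = ψ_l − e_lᵏ f_k` solve the homogeneous transport system `D₀ C_l = ∑_m M_{lm} C_m`
(`WaveFrame.D0_defect`), and smooth solutions of `∂_t C = βʲ ∂_j C + M C` with zero data vanish in
the double cone over the data ball — energy `∑ C_l²`, flux `−βʲ ∑ C_l²`, the cone energy lemma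
`FluidPDE.coneEnergy_eq_zero` of the tree and time reflection
(`WaveFrame.transport_eq_zero_forward`, `WaveFrame.transport_eventually_eq_zero`); then
`WaveFrame.P_eq` turns the `ϖ`-row into `P f = 0`. This is the constraint-propagation step of
John's reduction (John 1982, Ch. 5 §3; for Kerr–Schild backgrounds `curl_eq_zero`,
`waveOperator_uVar` of `KerrSchildSymmHypReduction.lean`).

## References

* F. John, *Partial differential equations*, 4th ed., Springer 1982, Ch. 5 §3. [John1982]
* R. Racke, *Lectures on Nonlinear Evolution Equations*, 2nd ed. 2015, Ch. 3 Thm 3.1. [Racke2015]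
-/

noncomputable section

open Set Filter Metric
open scoped Topology ContDiff

namespace Literature.Analysis.PDE

namespace WaveFrame

open VarWave

variable {n : ℕ}

/-! ### Transport systems: uniqueness in the cone -/

section Transport

variable {m : ℕ} {β : Fin n → Pt n → ℝ} {M : Fin m → Fin m → Pt n → ℝ} {C : Fin m → Pt n → ℝ}

/-- **Smooth solutions of a linear transport system `∂_t C_l = βʲ ∂_j C_l + ∑ₘ M_{lm} C_m` with
zero data vanish in the forward cone over the data ball.** [cite: Racke2015, Ch. 3 Thm 3.1] -/
theorem transport_eq_zero_forward (hβ : ∀ j, ContDiff ℝ ∞ (β j))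
    (hM : ∀ l l', Continuous (M l l')) (hC : ∀ l, ContDiff ℝ ∞ (C l)) {T ρ : ℝ}
    {x₁ : EuclideanSpace ℝ (Fin n)}
    (heq : ∀ p ∈ Icc 0 T ×ˢ closedBall x₁ ρ, ∀ l,
      dT (C l) p = ∑ j, β j p * dX (C l) j p + ∑ l', M l l' p * C l' p)
    (h0 : ∀ x ∈ closedBall x₁ ρ, ∀ l, C l (0, x) = 0) :
    ∃ c : ℝ, 0 < c ∧ ∀ t ∈ Icc 0 T, ∀ x, dist x x₁ < ρ - c * t → ∀ l, C l (t, x) = 0 := by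
  set Z : Set (Pt n) := Icc 0 T ×ˢ closedBall x₁ ρ with hZ
  have hZc : IsCompact Z := isCompact_Icc.prod (isCompact_closedBall x₁ ρ)
  -- bounds for `β`, `∂ⱼβʲ`, `M` on `Z`
  set Φ : Pt n → ℝ := fun p ↦ ∑ j, |β j p| + ∑ j, |dX (β j) j p| + ∑ l, ∑ l', |M l l' p| with hΦ
  have hΦc : Continuous Φ :=
    ((continuous_finsetSum _ fun j _ ↦ (hβ j).continuous.abs).add
      (continuous_finsetSum _ fun j _ ↦ (contDiff_dX (hβ j) j).continuous.abs)).add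
      (continuous_finsetSum _ fun l _ ↦ continuous_finsetSum _ fun l' _ ↦ (hM l l').abs)
  obtain ⟨Λ', hΛ'⟩ := hZc.exists_bound_of_continuousOn hΦc.continuousOn
  set Λ := max Λ' 0 with hΛdef
  have hΛnn : 0 ≤ Λ := le_max_right _ _
  have hΦle : ∀ p ∈ Z, Φ p ≤ Λ := fun p hp ↦ by
    have h := hΛ' p hp
    rw [Real.norm_of_nonneg (by positivity)] at h
    exact h.trans (le_max_left _ _)
  have hβb : ∀ p ∈ Z, ∑ j, |β j p| ≤ Λ := fun p hp ↦ by
    have h := hΦle p hp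
    have : 0 ≤ ∑ j, |dX (β j) j p| := by positivity
    have : 0 ≤ ∑ l, ∑ l', |M l l' p| := by positivity
    simp only [hΦ] at h; linarith
  have hdβb : ∀ p ∈ Z, |∑ j, dX (β j) j p| ≤ Λ := fun p hp ↦ by
    have h := hΦle p hp
    have : 0 ≤ ∑ j, |β j p| := by positivity
    have : 0 ≤ ∑ l, ∑ l', |M l l' p| := by positivity
    refine (Finset.abs_sum_le_sum_abs _ _).trans ?_
    simp only [hΦ] at h; linarith
  have hMb : ∀ p ∈ Z, ∀ l l', |M l l' p| ≤ Λ := fun p hp l l' ↦ by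
    have h := hΦle p hp
    have : 0 ≤ ∑ j, |β j p| := by positivity
    have : 0 ≤ ∑ j, |dX (β j) j p| := by positivity
    have h1 : |M l l' p| ≤ ∑ l, ∑ l', |M l l' p| :=
      (Finset.single_le_sum (f := fun l' ↦ |M l l' p|) (fun _ _ ↦ abs_nonneg _)
        (Finset.mem_univ l')).trans
        (Finset.single_le_sum (f := fun l ↦ ∑ l', |M l l' p|) (fun _ _ ↦ by positivity)
          (Finset.mem_univ l))
    simp only [hΦ] at h; linarith
  -- energy and flux
  set en : Pt n → ℝ := fun p ↦ ∑ l, C l p ^ 2 with hen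
  set fl : Fin n → Pt n → ℝ := fun j p ↦ -(β j p * en p) with hfl
  have henc : ContDiff ℝ ∞ en := ContDiff.sum fun l _ ↦ (hC l).pow 2
  have hflc : ∀ j, ContDiff ℝ ∞ (fl j) := fun j ↦ ((hβ j).mul henc).neg
  have hen_nn : ∀ p, 0 ≤ en p := fun p ↦ by positivity
  obtain ⟨K, hK⟩ := hZc.exists_bound_of_continuousOn
    ((henc.continuous_fderiv (by simp)).continuousOn)
  -- derivatives of the energy
  have hdC : ∀ l p, DifferentiableAt ℝ (C l) p := fun l p ↦ (hC l).differentiableAt_top p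
  have hden : ∀ p (v : Pt n), fderiv ℝ en p v = ∑ l, 2 * C l p * fderiv ℝ (C l) p v := by
    intro p v
    have : en = fun q ↦ ∑ l, C l q ^ 2 := rfl
    rw [this, fderiv_fun_sum (A := fun l q ↦ C l q ^ 2) fun l _ ↦ (hdC l p).pow 2]
    simp only [FunLike.coe_sum, Finset.sum_apply]
    refine Finset.sum_congr rfl fun l _ ↦ ?_
    rw [show (fun q ↦ C l q ^ 2) = fun q ↦ C l q * C l q from funext fun q ↦ sq _,
      fderiv_fun_mul (hdC l p) (hdC l p)]
    simp only [_root_.add_apply, FunLike.coe_smul, Pi.smul_apply, smul_eq_mul]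
    ring
  set c : ℝ := Λ + 1 with hc
  have hcpos : 0 < c := by positivity
  refine ⟨c, hcpos, fun t ht x hx l ↦ ?_⟩
  -- trivial cases
  rcases le_or_gt ρ 0 with hρ | hρ
  · exfalso
    have : 0 ≤ c * t := mul_nonneg hcpos.le ht.1
    linarith [dist_nonneg (x := x) (y := x₁)]
  have hxball : x ∈ closedBall x₁ ρ := by
    rw [mem_closedBall]
    have : 0 ≤ c * t := mul_nonneg hcpos.le ht.1
    linarith
  rcases ht.1.eq_or_lt with hzero | htpos
  · rw [← hzero]; exact h0 x hxball l
  -- the energy vanishes in the cone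
  have hE : en (t, x) = 0 := by
    refine Literature.Analysis.FluidPDE.coneEnergy_eq_zero (d := n) (τ := 0) (τ' := T) (ρ := ρ)
      (c := c) (M := 2 * m * Λ + Λ) (C := K) (x₁ := x₁) (e := en) (f := fl)
      hcpos.le henc.continuous.continuousOn (henc.of_le (by simp)).contDiffOn
      (fun j ↦ ((hflc j).of_le (by simp)).contDiffOn)
      (fun p hp ↦ hK p ⟨Ioo_subset_Icc_self hp.1, hp.2⟩)
      (fun p _ ↦ hen_nn p) (fun p hp ↦ ?_) (fun p hp ν hν ↦ ?_) (fun y hy ↦ ?_) ⟨htpos, ht.2⟩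
      (by rw [sub_zero]; exact hx)
    · -- bulk inequality
      have hpZ : p ∈ Z := ⟨Ioo_subset_Icc_self hp.1, hp.2⟩
      have hfl' : ∀ j, fderiv ℝ (fl j) p (0, EuclideanSpace.single j 1) =
          -(dX (β j) j p * en p + β j p * dX en j p) := fun j ↦ by
        have : fl j = fun q ↦ -(β j q * en q) := rfl
        rw [this, fderiv_fun_neg, _root_.neg_apply,
          fderiv_fun_mul ((hβ j).differentiableAt_top p) (henc.differentiableAt_top p)]
        simp only [_root_.add_apply, FunLike.coe_smul, Pi.smul_apply, smul_eq_mul]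
        unfold dX
        ring
      have heT : fderiv ℝ en p (1, 0) = ∑ l, 2 * C l p * dT (C l) p := hden p _
      have heX : ∀ j, dX en j p = ∑ l, 2 * C l p * dX (C l) j p := fun j ↦ hden p _
      rw [heT]
      simp only [hfl', heX, heq p hpZ]
      -- the transport terms cancel; bound the rest
      have hA : ∑ l, 2 * C l p * ∑ j, β j p * dX (C l) j p =
          ∑ j, β j p * ∑ l, 2 * C l p * dX (C l) j p := by
        simp only [Finset.mul_sum]
        rw [Finset.sum_comm]
        exact Finset.sum_congr rfl fun j _ ↦ Finset.sum_congr rfl fun l _ ↦ by ring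
      have hB : ∑ l, 2 * C l p * ∑ l', M l l' p * C l' p =
          2 * ∑ l, ∑ l', M l l' p * (C l p * C l' p) := by
        simp only [Finset.mul_sum]
        exact Finset.sum_congr rfl fun l _ ↦ Finset.sum_congr rfl fun l' _ ↦ by ring
      have split1 : ∑ l, 2 * C l p * (∑ j, β j p * dX (C l) j p + ∑ l', M l l' p * C l' p) =
          ∑ j, β j p * ∑ l, 2 * C l p * dX (C l) j p +
            2 * ∑ l, ∑ l', M l l' p * (C l p * C l' p) := by
        rw [← hA, ← hB, ← Finset.sum_add_distrib]
        exact Finset.sum_congr rfl fun l _ ↦ by ring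
      have split2 : ∑ j, -(dX (β j) j p * en p + β j p * ∑ l, 2 * C l p * dX (C l) j p) =
          -((∑ j, dX (β j) j p) * en p) - ∑ j, β j p * ∑ l, 2 * C l p * dX (C l) j p := by
        rw [Finset.sum_mul, ← Finset.sum_neg_distrib, ← Finset.sum_sub_distrib]
        exact Finset.sum_congr rfl fun j _ ↦ by ring
      rw [split1, split2]
      have h1 : 2 * ∑ l, ∑ l', M l l' p * (C l p * C l' p) ≤ 2 * m * Λ * en p := by
        have h2 : ∀ l l', M l l' p * (C l p * C l' p) ≤ Λ * ((C l p ^ 2 + C l' p ^ 2) / 2) :=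
          fun l l' ↦ by
          have h3 : |M l l' p * (C l p * C l' p)| ≤ Λ * ((C l p ^ 2 + C l' p ^ 2) / 2) := by
            rw [abs_mul, abs_mul]
            have hxy : |C l p| * |C l' p| ≤ (C l p ^ 2 + C l' p ^ 2) / 2 := by
              rw [← sq_abs (C l p), ← sq_abs (C l' p)]
              nlinarith [sq_nonneg (|C l p| - |C l' p|), abs_nonneg (C l p), abs_nonneg (C l' p)]
            exact mul_le_mul (hMb p hpZ l l') hxy (by positivity) hΛnn
          exact (le_abs_self _).trans h3
        have h4 : ∑ l, ∑ l', M l l' p * (C l p * C l' p) ≤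
            ∑ l : Fin m, ∑ l' : Fin m, Λ * ((C l p ^ 2 + C l' p ^ 2) / 2) :=
          Finset.sum_le_sum fun l _ ↦ Finset.sum_le_sum fun l' _ ↦ h2 l l'
        have h5a : ∑ l : Fin m, ∑ l' : Fin m, (C l p ^ 2 + C l' p ^ 2) = 2 * m * en p := by
          have e1 : ∀ l : Fin m, ∑ l' : Fin m, (C l p ^ 2 + C l' p ^ 2) = m * C l p ^ 2 + en p :=
            fun l ↦ by
            rw [Finset.sum_add_distrib, Finset.sum_const, Finset.card_univ, Fintype.card_fin,
              nsmul_eq_mul]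
          rw [Finset.sum_congr rfl fun l _ ↦ e1 l, Finset.sum_add_distrib, ← Finset.mul_sum,
            Finset.sum_const, Finset.card_univ, Fintype.card_fin, nsmul_eq_mul]
          simp only [hen]
          ring
        have h5 : ∑ l : Fin m, ∑ l' : Fin m, Λ * ((C l p ^ 2 + C l' p ^ 2) / 2) = m * Λ * en p := by
          have e2 : ∀ l l' : Fin m, Λ * ((C l p ^ 2 + C l' p ^ 2) / 2) =
              Λ / 2 * (C l p ^ 2 + C l' p ^ 2) := fun l l' ↦ by ring
          simp only [e2, ← Finset.mul_sum]
          rw [h5a]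
          ring
        linarith
      have h6 : -((∑ j, dX (β j) j p) * en p) ≤ Λ * en p := by
        have h7 : -(∑ j, dX (β j) j p) ≤ Λ := (neg_le_abs _).trans (hdβb p hpZ)
        nlinarith [hen_nn p]
      nlinarith [hen_nn p]
    · -- cone condition
      have h1 : ∑ j, ν j * fl j p = -((∑ j, ν j * β j p) * en p) := by
        simp only [hfl]
        rw [Finset.sum_mul, ← Finset.sum_neg_distrib]
        exact Finset.sum_congr rfl fun j _ ↦ by ring
      rw [h1, abs_neg, abs_mul, abs_of_nonneg (hen_nn p)]
      have h2 : |∑ j, ν j * β j p| ≤ Λ := by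
        refine (Finset.abs_sum_le_sum_abs _ _).trans ?_
        have h3 : ∀ j, |ν j * β j p| ≤ |β j p| := fun j ↦ by
          rw [abs_mul]
          have h4 : |ν j| ≤ 1 := (abs_apply_le_norm ν j).trans hν
          have h5 : 0 ≤ |β j p| := abs_nonneg _
          nlinarith [abs_nonneg (ν j)]
        exact (Finset.sum_le_sum fun j _ ↦ h3 j).trans (hβb p hp)
      calc |∑ j, ν j * β j p| * en p ≤ Λ * en p := mul_le_mul_of_nonneg_right h2 (hen_nn p)
        _ ≤ c * en p := by rw [hc]; nlinarith [hen_nn p]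
    · -- vanishing initial energy
      simp [hen, h0 y hy]
  have h3 : C l (t, x) ^ 2 ≤ en (t, x) :=
    Finset.single_le_sum (f := fun l ↦ C l (t, x) ^ 2) (fun _ _ ↦ sq_nonneg _) (Finset.mem_univ l)
  rw [hE] at h3
  exact pow_eq_zero_iff two_ne_zero |>.1 (le_antisymm h3 (sq_nonneg _))

end Transport

/-! ### Two-sided transport uniqueness near the base point -/

section TwoSided

variable {m : ℕ} {β : Fin n → Pt n → ℝ} {M : Fin m → Fin m → Pt n → ℝ} {C : Fin m → Pt n → ℝ}

/-- **Smooth solutions of `∂_t C = βʲ ∂_j C + M C` with zero data near `x₁` vanish near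
`(0, x₁)`** (forward cone and, by time reflection, backward cone). [cite: Racke2015, Ch. 3 Thm 3.1] -/
theorem transport_eventually_eq_zero (hβ : ∀ j, ContDiff ℝ ∞ (β j))
    (hM : ∀ l l', Continuous (M l l')) (hC : ∀ l, ContDiff ℝ ∞ (C l))
    (heq : ∀ p l, dT (C l) p = ∑ j, β j p * dX (C l) j p + ∑ l', M l l' p * C l' p)
    {x₁ : EuclideanSpace ℝ (Fin n)} (h0 : ∀ᶠ y in 𝓝 x₁, ∀ l, C l (0, y) = 0) :
    ∀ᶠ p in 𝓝 ((0 : ℝ), x₁), ∀ l, C l p = 0 := by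
  obtain ⟨r, hr, hball⟩ := Metric.eventually_nhds_iff.1 h0
  set ρ := r / 2 with hρ
  have hρpos : 0 < ρ := by positivity
  have h0' : ∀ y ∈ closedBall x₁ ρ, ∀ l, C l (0, y) = 0 := fun y hy ↦
    hball (lt_of_le_of_lt (mem_closedBall.1 hy) (by rw [hρ]; linarith))
  -- forward
  obtain ⟨cf, hcf, Hf⟩ := transport_eq_zero_forward (T := 1) (ρ := ρ) hβ hM hC
    (fun p _ l ↦ heq p l) h0'
  -- backward, by time reflection
  have hβ' : ∀ j, ContDiff ℝ ∞ (fun p : Pt n ↦ -β j (timeReflect p)) := fun j ↦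
    (contDiff_comp_timeReflect (hβ j)).neg
  have hM' : ∀ l l', Continuous (fun p : Pt n ↦ -M l l' (timeReflect p)) := fun l l' ↦
    ((hM l l').comp (timeReflect (d := n)).continuous).neg
  have hC' : ∀ l, ContDiff ℝ ∞ (C l ∘ timeReflect) := fun l ↦ contDiff_comp_timeReflect (hC l)
  have heq' : ∀ p l, dT (C l ∘ timeReflect) p =
      ∑ j, (-β j (timeReflect p)) * dX (C l ∘ timeReflect) j p +
        ∑ l', (-M l l' (timeReflect p)) * (C l' ∘ timeReflect) p := fun p l ↦ by
    rw [dT_comp_timeReflect (hC l), heq (timeReflect p) l]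
    simp only [dX_comp_timeReflect (hC l), Function.comp_apply, neg_mul, Finset.sum_neg_distrib,
      neg_add]
  obtain ⟨cb, hcb, Hb⟩ := transport_eq_zero_forward (T := 1) (ρ := ρ) (β := fun j p ↦ -β j (timeReflect p))
    (M := fun l l' p ↦ -M l l' (timeReflect p)) (C := fun l ↦ C l ∘ timeReflect) hβ' hM' hC'
    (fun p _ l ↦ heq' p l)
    (fun y hy l ↦ by simp only [Function.comp_apply, timeReflect_apply, neg_zero]; exact h0' y hy l)
  -- the neighbourhood
  set c := max cf cb with hc
  have hcpos : 0 < c := lt_max_of_lt_left hcf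
  set ε := min 1 (ρ / (2 * c)) with hε
  have hεpos : 0 < ε := lt_min one_pos (by positivity)
  set N : Set (Pt n) := {p | |p.1| < ε ∧ dist p.2 x₁ < ρ / 2} with hN
  have hNo : IsOpen N :=
    (isOpen_lt (continuous_abs.comp continuous_fst) continuous_const).inter
      (isOpen_lt (continuous_snd.dist continuous_const) continuous_const)
  have hNmem : ((0 : ℝ), x₁) ∈ N := ⟨by simpa using hεpos, by simp; positivity⟩
  filter_upwards [hNo.mem_nhds hNmem] with p hp l
  obtain ⟨hp1, hp2⟩ := hp
  have hε1 : ε ≤ 1 := min_le_left _ _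
  have hεc : c * ε ≤ ρ / 2 := by
    have h := min_le_right 1 (ρ / (2 * c))
    rw [← hε] at h
    calc c * ε ≤ c * (ρ / (2 * c)) := mul_le_mul_of_nonneg_left h hcpos.le
      _ = ρ / 2 := by field_simp
  rcases le_or_gt 0 p.1 with ht | ht
  · -- forward
    have hlt : p.1 < ε := (abs_lt.1 hp1).2
    have hdist : dist p.2 x₁ < ρ - cf * p.1 := by
      have : cf * p.1 ≤ c * ε :=
        (mul_le_mul_of_nonneg_right (le_max_left _ _) ht).trans
          (mul_le_mul_of_nonneg_left hlt.le hcpos.le)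
      linarith
    exact Hf p.1 ⟨ht, by linarith⟩ p.2 hdist l
  · -- backward
    have hlt : -p.1 < ε := (abs_lt.1 hp1).1 |> fun h ↦ by linarith
    have hdist : dist p.2 x₁ < ρ - cb * (-p.1) := by
      have : cb * (-p.1) ≤ c * ε :=
        (mul_le_mul_of_nonneg_right (le_max_right _ _) (by linarith)).trans
          (mul_le_mul_of_nonneg_left hlt.le hcpos.le)
      linarith
    have h := Hb (-p.1) ⟨by linarith, by linarith⟩ p.2 hdist l
    simpa using h

end TwoSided

/-- Cyclic reindexing of a triple sum: `∑ₖ ∑ⱼ ∑ₘ T k j m = ∑ₘ ∑ₖ ∑ⱼ T k j m`. [folklore] -/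
theorem sum_comm_231 {ι κ μ : Type*} [Fintype ι] [Fintype κ] [Fintype μ] (T : ι → κ → μ → ℝ) :
    ∑ k, ∑ j, ∑ m, T k j m = ∑ m, ∑ k, ∑ j, T k j m := by
  have h1 : ∑ k, ∑ j, ∑ m, T k j m = ∑ k, ∑ m, ∑ j, T k j m :=
    Finset.sum_congr rfl fun k _ ↦ Finset.sum_comm
  rw [h1, Finset.sum_comm]

/-! ### The rows of the first-order system and the defect transport identity -/

section Rows

variable {a : Pt n → ℝ} {β : Fin n → Pt n → ℝ} {Q h e : Fin n → Fin n → Pt n → ℝ}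
  {bT c : Pt n → ℝ} {bX : Fin n → Pt n → ℝ}

/-- `D₀` of a difference. [folklore] -/
theorem D0_fun_sub {g u : Pt n → ℝ} {p : Pt n} (hg : DifferentiableAt ℝ g p)
    (hu : DifferentiableAt ℝ u p) :
    D0 β (fun q ↦ g q - u q) p = D0 β g p - D0 β u p := by
  unfold D0
  rw [dT_fun_sub hg hu]
  simp only [dX_fun_sub hg hu, mul_sub, Finset.sum_sub_distrib]
  ring

/-- The lowered frame `ẽ_{mk} = ∑ⱼ h_{kj} e_mʲ`. [cite: John1982, Ch. 5 §3] -/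
def etil (h e : Fin n → Fin n → Pt n → ℝ) (m k : Fin n) (q : Pt n) : ℝ :=
  ∑ j, h k j q * e m j q

/-- `F_k = ∑ₘ ẽ_{mk} ψ_m`, the reconstruction of `f_k` from the frame components `ψ`.
[cite: John1982, Ch. 5 §3] -/
def Fv (h e : Fin n → Fin n → Pt n → ℝ) (ψ : Fin n → Pt n → ℝ) (k : Fin n) (q : Pt n) : ℝ :=
  ∑ m, etil h e m k q * ψ m q

/-- **Reconstruction**: `∑ₘ ẽ_{mk} (e_mⁱ f_i) = f_k` when `∑_l e_lʲ e_lⁱ = Q^{ji}` and `h Q = 1`.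
[folklore] -/
theorem Fv_psiF (hQ : ∀ j k q, ∑ l, e l j q * e l k q = Q j k q)
    (hinv : ∀ k i q, ∑ j, h k j q * Q j i q = if k = i then 1 else 0) (f : Pt n → ℝ) (k : Fin n)
    (q : Pt n) : Fv h e (psiF e f) k q = dX f k q := by
  classical
  unfold Fv etil psiF
  have e1 : ∀ m, (∑ j, h k j q * e m j q) * (∑ i, e m i q * dX f i q) =
      ∑ i, ∑ j, h k j q * e m j q * e m i q * dX f i q := fun m ↦ by
    rw [Finset.sum_mul_sum, Finset.sum_comm]
    exact Finset.sum_congr rfl fun i _ ↦ Finset.sum_congr rfl fun j _ ↦ by ring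
  rw [Finset.sum_congr rfl fun m _ ↦ e1 m, Finset.sum_comm]
  have e2 : ∀ i, ∑ m, ∑ j, h k j q * e m j q * e m i q * dX f i q =
      (∑ j, h k j q * Q j i q) * dX f i q := fun i ↦ by
    rw [Finset.sum_mul, Finset.sum_comm]
    refine Finset.sum_congr rfl fun j _ ↦ ?_
    rw [← hQ j i q, Finset.mul_sum, Finset.sum_mul]
    exact Finset.sum_congr rfl fun m _ ↦ by ring
  rw [Finset.sum_congr rfl fun i _ ↦ e2 i]
  simp only [hinv, ite_mul, one_mul, zero_mul, Finset.sum_ite_eq, Finset.mem_univ, if_true]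

/-- `F` is linear in `ψ`. [folklore] -/
theorem Fv_sub (ψ ψ' : Fin n → Pt n → ℝ) (k : Fin n) (q : Pt n) :
    Fv h e ψ k q - Fv h e ψ' k q = ∑ m, etil h e m k q * (ψ m q - ψ' m q) := by
  unfold Fv
  rw [← Finset.sum_sub_distrib]
  exact Finset.sum_congr rfl fun m _ ↦ by ring

/-- `F` only depends on the values of `ψ` at the point. [folklore] -/
theorem Fv_congr {ψ ψ' : Fin n → Pt n → ℝ} {q : Pt n} (hψ : ∀ m, ψ m q = ψ' m q) (k : Fin n) :
    Fv h e ψ k q = Fv h e ψ' k q := by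
  unfold Fv
  simp only [hψ]

/-- The coefficient matrix of the defect transport system:
`M_{lm} = ∑ₖ (D₀ e_lᵏ) ẽ_{mk} + ∑ₖ e_lᵏ ∑ⱼ (∂_k βʲ) ẽ_{mj}`. [cite: John1982, Ch. 5 §3] -/
def Mco (β : Fin n → Pt n → ℝ) (h e : Fin n → Fin n → Pt n → ℝ) (l m : Fin n) (q : Pt n) : ℝ :=
  ∑ k, D0 β (e l k) q * etil h e m k q + ∑ k, e l k q * ∑ j, dX (β j) k q * etil h e m j q

/-- **The `ψ`-row** of the first-order system (right-hand side of `D₀ ψ_l`):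
`(√a)⁻¹ e_lᵏ ∂_k ϖ + (D₀ e_lᵏ) F_k + (e_lᵏ ∂_k (√a)⁻¹) ϖ + e_lᵏ (∂_k βʲ) F_j`.
[cite: John1982, Ch. 5 §3] -/
def rowPsi (a : Pt n → ℝ) (β : Fin n → Pt n → ℝ) (h e : Fin n → Fin n → Pt n → ℝ)
    (ϖ : Pt n → ℝ) (ψ : Fin n → Pt n → ℝ) (l : Fin n) (q : Pt n) : ℝ :=
  (Real.sqrt (a q))⁻¹ * ∑ k, e l k q * dX ϖ k q +
    ∑ k, D0 β (e l k) q * Fv h e ψ k q +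
    (∑ k, e l k q * dX (fun r ↦ (Real.sqrt (a r))⁻¹) k q) * ϖ q +
    ∑ k, e l k q * ∑ j, dX (β j) k q * Fv h e ψ j q

/-- The bracket of the `ϖ`-row: `√a (D₀√a) (√a)⁻¹ ϖ − a (D₀βʲ) F_j + e_lʲ ∂_j ψ_l
− e_lʲ (∂_j e_lᵏ) F_k + b_T ((√a)⁻¹ ϖ + βʲ F_j) + b_Xʲ F_j + c f`. [cite: John1982, Ch. 5 §3] -/
def bracketPi (a : Pt n → ℝ) (β : Fin n → Pt n → ℝ) (h e : Fin n → Fin n → Pt n → ℝ)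
    (bT : Pt n → ℝ) (bX : Fin n → Pt n → ℝ) (c : Pt n → ℝ) (f ϖ : Pt n → ℝ)
    (ψ : Fin n → Pt n → ℝ) (q : Pt n) : ℝ :=
  Real.sqrt (a q) * D0 β (fun r ↦ Real.sqrt (a r)) q * ((Real.sqrt (a q))⁻¹ * ϖ q) -
    a q * ∑ j, D0 β (β j) q * Fv h e ψ j q +
    ∑ l, ∑ j, e l j q * dX (ψ l) j q -
    ∑ l, ∑ j, ∑ k, e l j q * dX (e l k) j q * Fv h e ψ k q +
    bT q * ((Real.sqrt (a q))⁻¹ * ϖ q + ∑ j, β j q * Fv h e ψ j q) +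
    ∑ j, bX j q * Fv h e ψ j q + c q * f q

/-- **The `ϖ`-row** of the first-order system (right-hand side of `D₀ ϖ`): `(√a)⁻¹ · bracket`.
[cite: John1982, Ch. 5 §3] -/
def rowPi (a : Pt n → ℝ) (β : Fin n → Pt n → ℝ) (h e : Fin n → Fin n → Pt n → ℝ)
    (bT : Pt n → ℝ) (bX : Fin n → Pt n → ℝ) (c : Pt n → ℝ) (f ϖ : Pt n → ℝ)
    (ψ : Fin n → Pt n → ℝ) (q : Pt n) : ℝ :=
  (Real.sqrt (a q))⁻¹ * bracketPi a β h e bT bX c f ϖ ψ q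

/-- For a solution of the `f`-row, `π̃(f) = ϖ`. [folklore] -/
theorem piT_eq_of_row (hapos : ∀ q, 0 < a q) {f ϖ : Pt n → ℝ}
    (Rf : ∀ q, D0 β f q = (Real.sqrt (a q))⁻¹ * ϖ q) : piT a β f = ϖ := by
  funext q
  unfold piT
  rw [Rf q, ← mul_assoc, mul_inv_cancel₀ (Real.sqrt_pos.2 (hapos q)).ne', one_mul]

/-- **The defect transport identity**: for a smooth solution of the `f`- and `ψ`-rows, the
defects `C_l = ψ_l − e_lᵏ f_k` satisfy `D₀ C_l = ∑ₘ M_{lm} C_m`. [cite: John1982, Ch. 5 §3] -/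
theorem D0_defect (ha : ContDiff ℝ ∞ a) (hapos : ∀ q, 0 < a q) (hβ : ∀ j, ContDiff ℝ ∞ (β j))
    (he : ∀ l k, ContDiff ℝ ∞ (e l k)) (hQ : ∀ j k q, ∑ l, e l j q * e l k q = Q j k q)
    (hinv : ∀ k i q, ∑ j, h k j q * Q j i q = if k = i then 1 else 0)
    {f ϖ : Pt n → ℝ} {ψ : Fin n → Pt n → ℝ} (hf : ContDiff ℝ ∞ f) (hψ : ∀ l, ContDiff ℝ ∞ (ψ l))
    (Rf : ∀ q, D0 β f q = (Real.sqrt (a q))⁻¹ * ϖ q)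
    (Rψ : ∀ q l, D0 β (ψ l) q = rowPsi a β h e ϖ ψ l q) (l : Fin n) (q : Pt n) :
    D0 β (fun r ↦ ψ l r - psiF e f l r) q =
      ∑ m, Mco β h e l m q * (ψ m q - psiF e f m q) := by
  have hpi := piT_eq_of_row hapos Rf
  rw [D0_fun_sub ((hψ l).differentiableAt_top q) ((contDiff_psiF he hf l).differentiableAt_top q),
    Rψ q l, D0_psiF ha hapos hβ he hf l q, hpi]
  have hF : ∀ k, Fv h e ψ k q - dX f k q = ∑ m, etil h e m k q * (ψ m q - psiF e f m q) :=
    fun k ↦ by rw [← Fv_psiF hQ hinv f k q, Fv_sub]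
  -- both sides equal `∑ₖ D₀e_lᵏ (F_k − f_k) + ∑ₖ e_lᵏ ∑ⱼ ∂_kβʲ (F_j − f_j)`
  have lhs : rowPsi a β h e ϖ ψ l q -
      ((Real.sqrt (a q))⁻¹ * ∑ k, e l k q * dX ϖ k q + ∑ k, D0 β (e l k) q * dX f k q +
        (∑ k, e l k q * dX (fun r ↦ (Real.sqrt (a r))⁻¹) k q) * ϖ q +
        ∑ k, e l k q * ∑ j, dX (β j) k q * dX f j q) =
      ∑ k, D0 β (e l k) q * (Fv h e ψ k q - dX f k q) +
        ∑ k, e l k q * ∑ j, dX (β j) k q * (Fv h e ψ j q - dX f j q) := by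
    unfold rowPsi
    simp only [mul_sub, Finset.sum_sub_distrib, Finset.mul_sum]
    ring
  rw [lhs]
  simp only [hF]
  have eq1 : ∑ k, D0 β (e l k) q * ∑ m, etil h e m k q * (ψ m q - psiF e f m q) =
      ∑ m, (∑ k, D0 β (e l k) q * etil h e m k q) * (ψ m q - psiF e f m q) := by
    simp only [Finset.mul_sum, Finset.sum_mul]
    rw [Finset.sum_comm]
    exact Finset.sum_congr rfl fun m _ ↦ Finset.sum_congr rfl fun k _ ↦ by ring
  have eq2 : ∑ k, e l k q * ∑ j, dX (β j) k q * ∑ m, etil h e m j q * (ψ m q - psiF e f m q) =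
      ∑ m, (∑ k, e l k q * ∑ j, dX (β j) k q * etil h e m j q) * (ψ m q - psiF e f m q) := by
    calc ∑ k, e l k q * ∑ j, dX (β j) k q * ∑ m, etil h e m j q * (ψ m q - psiF e f m q)
        = ∑ k, ∑ j, ∑ m, e l k q * dX (β j) k q * etil h e m j q * (ψ m q - psiF e f m q) := by
          simp only [Finset.mul_sum]
          exact Finset.sum_congr rfl fun k _ ↦ Finset.sum_congr rfl fun j _ ↦
            Finset.sum_congr rfl fun m _ ↦ by ring
      _ = ∑ m, ∑ k, ∑ j, e l k q * dX (β j) k q * etil h e m j q * (ψ m q - psiF e f m q) :=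
          sum_comm_231 _
      _ = ∑ m, (∑ k, e l k q * ∑ j, dX (β j) k q * etil h e m j q) * (ψ m q - psiF e f m q) := by
          simp only [Finset.mul_sum, Finset.sum_mul]
          exact Finset.sum_congr rfl fun m _ ↦ Finset.sum_congr rfl fun k _ ↦
            Finset.sum_congr rfl fun j _ ↦ by ring
  rw [eq1, eq2, ← Finset.sum_add_distrib]
  exact Finset.sum_congr rfl fun m _ ↦ by unfold Mco; ring

/-! ### Recovery of the second-order equation -/

/-- **Recovery.** Let `(f, ϖ, ψ)` be a smooth solution of the three rows of the first-order
system, with `ψ_l = e_lᵏ f_k` at `t = 0` near `x₁`. Then near `(0, x₁)` the constraint persists,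
`ψ_l = e_lᵏ f_k`, and `f` solves the second-order equation `P f = 0`.
[cite: John1982, Ch. 5 §3] -/
theorem eventually_P_eq_zero_of_rows (ha : ContDiff ℝ ∞ a) (hapos : ∀ q, 0 < a q)
    (hβ : ∀ j, ContDiff ℝ ∞ (β j)) (hh : ∀ j k, ContDiff ℝ ∞ (h j k))
    (he : ∀ l k, ContDiff ℝ ∞ (e l k)) (hQ : ∀ j k q, ∑ l, e l j q * e l k q = Q j k q)
    (hinv : ∀ k i q, ∑ j, h k j q * Q j i q = if k = i then 1 else 0)
    {f ϖ : Pt n → ℝ} {ψ : Fin n → Pt n → ℝ} (hf : ContDiff ℝ ∞ f) (hψ : ∀ l, ContDiff ℝ ∞ (ψ l))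
    (Rf : ∀ q, D0 β f q = (Real.sqrt (a q))⁻¹ * ϖ q)
    (Rψ : ∀ q l, D0 β (ψ l) q = rowPsi a β h e ϖ ψ l q)
    (Rπ : ∀ q, D0 β ϖ q = rowPi a β h e bT bX c f ϖ ψ q)
    {x₁ : EuclideanSpace ℝ (Fin n)} (hcons : ∀ᶠ y in 𝓝 x₁, ∀ l, ψ l (0, y) = psiF e f l (0, y)) :
    ∀ᶠ p in 𝓝 ((0 : ℝ), x₁), (∀ l, ψ l p = psiF e f l p) ∧ P a β Q bT bX c f p = 0 := by
  have hpi := piT_eq_of_row hapos Rf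
  have hSne : ∀ q, Real.sqrt (a q) ≠ 0 := fun q ↦ (Real.sqrt_pos.2 (hapos q)).ne'
  -- the defects solve a smooth transport system with zero data
  set C : Fin n → Pt n → ℝ := fun l r ↦ ψ l r - psiF e f l r with hCdef
  have hCs : ∀ l, ContDiff ℝ ∞ (C l) := fun l ↦ (hψ l).sub (contDiff_psiF he hf l)
  have hetil : ∀ m k, ContDiff ℝ ∞ (etil h e m k) := fun m k ↦
    ContDiff.sum fun j _ ↦ (hh k j).mul (he m j)
  have hMc : ∀ l m, Continuous (Mco β h e l m) := fun l m ↦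
    ((continuous_finsetSum _ fun k _ ↦ (contDiff_D0 hβ (he l k)).continuous.mul
      (hetil m k).continuous).add
      (continuous_finsetSum _ fun k _ ↦ (he l k).continuous.mul
        (continuous_finsetSum _ fun j _ ↦ (contDiff_dX (hβ j) k).continuous.mul
          (hetil m j).continuous)))
  have heq : ∀ p l, dT (C l) p = ∑ j, β j p * dX (C l) j p + ∑ m, Mco β h e l m p * C m p := by
    intro p l
    have hD := D0_defect ha hapos hβ he hQ hinv hf hψ Rf Rψ l p
    unfold D0 at hD
    simp only [hCdef]
    linarith
  have h0 : ∀ᶠ y in 𝓝 x₁, ∀ l, C l (0, y) = 0 := by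
    filter_upwards [hcons] with y hy l
    simp only [hCdef, hy l, sub_self]
  have hzero := transport_eventually_eq_zero hβ hMc hCs heq h0
  -- an open set on which the constraint holds
  obtain ⟨O, hOsub, hOo, hOmem⟩ := _root_.eventually_nhds_iff.1 hzero
  have hψeq : ∀ p ∈ O, ∀ l, ψ l p = psiF e f l p := fun p hp l ↦ by
    have := hOsub p hp l
    simp only [hCdef] at this
    linarith
  filter_upwards [hOo.mem_nhds hOmem] with p hp
  refine ⟨hψeq p hp, ?_⟩
  -- substitute the rows into the frame form of `P f`
  have hdXψ : ∀ l j, dX (psiF e f l) j p = dX (ψ l) j p := fun l j ↦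
    (dX_congr hOo (fun q hq ↦ (hψeq q hq l)) j hp).symm
  have hF : ∀ k, Fv h e ψ k p = dX f k p := fun k ↦ by
    rw [Fv_congr (fun m ↦ hψeq p hp m) k, Fv_psiF hQ hinv]
  have hdT : dT f p = (Real.sqrt (a p))⁻¹ * ϖ p + ∑ j, β j p * dX f j p := by
    have := Rf p
    unfold D0 at this
    linarith
  rw [P_eq ha hapos hβ he hQ hf p, hpi, Rπ p]
  unfold rowPi
  rw [mul_inv_cancel_left₀ (hSne p)]
  unfold bracketPi
  simp only [hF, hdXψ, Rf p, hdT]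
  ring

end Rows


end WaveFrame

end Literature.Analysis.PDE
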